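import Summits.QuantumFields.YangMills.Theorems.PencilRigidityDiagonalMirrorRPRStubRpClosureDefs

/-!
# Crux `WeakCouplingHypercubicLimitRP` (stmt-QuantumFields-27398) / aside crux `DiagonalMirrorRPR` (stmt-QuantumFields-10604),
# door B (`sign-twisted-diagonal-trace`): the lattice SOCKET `OddTorusSwapPairingLiminf`, re-homed under `Theorems/` (κ2′)

Helper file (`--supports stmt-QuantumFields-27398 --as helper`) of the hand `hand-10604-wilsonDiagModel-2` (docket director-ym g23,
O4 WORD 18 (3)(i) / O4 WORD 20 (1) «κ2′ TO HAND-2 NOW»; price λ0 of the critic idea-crit-9 g12, REQUESTS 2026-08-31T15:23Z);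
it closes nothing by itself.

WHAT.  The ONE tree definition of the socket of door B and door C — `OddTorusSwapPairingLiminf r sch`: on the scheme's OWN odd tori
the swap-mirror Gram pairings of compact half-space curvature products have `liminf_k ≥ 0` — re-homed from §1 of the core workfile
`Cruxes/DiagonalMirrorRPR/Lines/sign_twisted_diagonal_trace_core.lean` (sha16 `2db7ee148edeb495`; concluded there by
`core_of : OddTwistGap 𝔪 → DiagLukewarm 𝔪 → Growth r sch → OddTorusSwapPairingLiminf r sch`) with its docstring, `variable` binders and body
BYTE-FOR-BYTE and in the SAME namespace `…Cruxes.DiagonalMirrorRPR.SignTwistedDiagonalTrace` — exactly the mechanism of κ1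
(`…Theorems.DiagonalMirrorRPRDiagonalSliceModelDefs`, p825205): the line writer re-points the core by `import` + deleting §1's `def`, and the
seat-4 skeleton `Sketch-stochastic-geometric.lean` drops its copy.  WHY NOW: the socket's text exists in THREE copies (core §1; seat-4
Sketch; the hypothesis of the LANDED D1 transfer `diagRPOfPlaneLimits_of_swapPairingLiminf`, p827255,
`…Theorems.PencilRigidityWeakCouplingHypercubicLimitRPDiagRPOfSwapPairing`, stated at `subseq sch φ hφ`) — no fourth: the next file needing
the socket (the ρ1 reshape's lattice stub D1′ `stub_oddTorusSwapPairingLiminf`, door-B/C suppliers) names THIS def.  The unfolding lemma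
`oddTorusSwapPairingLiminf_iff` (`Iff.rfl`) makes p827255's binder this def BY NAME after `rw`/`unfold` (its body is the def's body with
`sch := subseq sch φ hφ`, definitionally).  Imports only what the body needs (`…PencilRigidityDiagonalMirrorRPRStubRpClosureDefs` for
`E4`/`swap01` and the lattice Schwinger functions), as the core's §1 does.

HONEST FRAMING: vocabulary only (one `def … : Prop` with parameters — a PREDICATE on `(r, sch)`, the line's lattice statement, NOT a cited
fact and NOT a restatement of any registered obligation).  Finite-`k` swap-RP is FALSE on odd tori (`Theorems/DiagonalMirrorRPR/Negative/…`);
the socket is the ASYMPTOTIC statement.  Nothing is proved here; D1, ⟨27398⟩, its heart S6i and the aside ⟨10604⟩ are OPEN; the Yang–Mills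
mass gap is NOT proved here or anywhere in the tree.  No instance, no notation, `autoImplicit false`.

References: Osterwalder–Seiler, Ann. Phys. 110 (1978) §2–3; Fröhlich–Israel–Lieb–Simon, Comm. Math. Phys. 62 (1978) Thm 2.1;
Seiler, LNP 159 (1982) Ch. 2.
-/

set_option autoImplicit false

noncomputable section

open scoped SchwartzMap
open MeasureTheory Filter Topology
open Literature.MathematicalPhysics.QuantumLattice Literature.MathematicalPhysics.AQFT
  Literature.MathematicalPhysics.QuantumFieldTheory Literature.Probability.LatticeModels
open Summit.QuantumFields.YangMills.Cruxes.DiagonalMirrorRPR.ParityBridgeColdTraces (E4)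
open Summit.QuantumFields.YangMills.Cruxes.DiagonalMirrorRPR.ParityBridgeColdTraces.RpClosure (swap01)

namespace Summit.QuantumFields.YangMills.Cruxes.DiagonalMirrorRPR.SignTwistedDiagonalTrace

/-! ## §1 The lattice statement of the line (swap mirror on the scheme's own odd tori) -/

section Statement

variable {G : Type} [Group G] [TopologicalSpace G] [IsTopologicalGroup G] [CompactSpace G]
  [MeasurableSpace G] [BorelSpace G]

/-- **The lattice conclusion of the line.**  For every finite family `i ↦ ∏_j Φ_k(f i j)` of products (of any
degrees `n i`, degree `0` = the constant `1`) of smeared curvature fields with compactly supported, pairwise disjoint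
(in `j`) test functions in the open half-space `{x | x₁ < x₀}`, its swap mirror `σf i j = f i (rev j) ∘ swap₀₁`, and
real coefficients `c`, the Gram pairing `Σ_{i,i'} c_i c_{i'} ⟨∏_j Φ_k(σf i j) ∏_j Φ_k(f i' j)⟩_k` on the scheme's own
torus of side `2L_k+1` has `liminf_{k→∞} ≥ 0`.  (Asymptotic swap-RP; finite-`k` swap-RP is FALSE on odd tori —
`Disproof.lean` §4.) -/
def OddTorusSwapPairingLiminf (r : LatticeRep G) (sch : SpeciesScheme (YMSpecies G)) : Prop :=
  ∀ (m : ℕ) (n : Fin m → ℕ) (c : Fin m → ℝ) (f σf : (i : Fin m) → Fin (n i) → 𝓢(E4, ℝ)),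
    (∀ i j, HasCompactSupport (f i j : E4 → ℝ) ∧ tsupport (f i j : E4 → ℝ) ⊆ {x : E4 | x 1 < x 0}) →
    (∀ i (j j' : Fin (n i)), j ≠ j' → Disjoint (tsupport (f i j : E4 → ℝ)) (tsupport (f i j' : E4 → ℝ))) →
    (∀ i j (x : E4), σf i j x = f i (Fin.rev j) (swap01 x)) →
      0 ≤ Filter.liminf (fun k : ℕ => ∑ i, ∑ i', c i * c i' *
        latticeSchwinger r.ρ sch (fun s => s.F) k (n i + n i') (fun _ => r.curvature)
          (Fin.append (σf i) (f i'))) atTop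

/-- **Unfolding lemma** (`Iff.rfl`): the socket BY NAME is its body — so a hypothesis stated with the body verbatim (e.g. the binder of the
landed D1 transfer `diagRPOfPlaneLimits_of_swapPairingLiminf`, p827255, at the sub-scheme `subseq sch φ hφ`) is discharged by
`(oddTorusSwapPairingLiminf_iff r _).1 h`, and conversely. -/
theorem oddTorusSwapPairingLiminf_iff (r : LatticeRep G) (sch : SpeciesScheme (YMSpecies G)) :
    OddTorusSwapPairingLiminf r sch ↔
      ∀ (m : ℕ) (n : Fin m → ℕ) (c : Fin m → ℝ) (f σf : (i : Fin m) → Fin (n i) → 𝓢(E4, ℝ)),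
        (∀ i j, HasCompactSupport (f i j : E4 → ℝ) ∧ tsupport (f i j : E4 → ℝ) ⊆ {x : E4 | x 1 < x 0}) →
        (∀ i (j j' : Fin (n i)), j ≠ j' → Disjoint (tsupport (f i j : E4 → ℝ)) (tsupport (f i j' : E4 → ℝ))) →
        (∀ i j (x : E4), σf i j x = f i (Fin.rev j) (swap01 x)) →
          0 ≤ Filter.liminf (fun k : ℕ => ∑ i, ∑ i', c i * c i' *
            latticeSchwinger r.ρ sch (fun s => s.F) k (n i + n i') (fun _ => r.curvature)
              (Fin.append (σf i) (f i'))) atTop :=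
  Iff.rfl

end Statement

end Summit.QuantumFields.YangMills.Cruxes.DiagonalMirrorRPR.SignTwistedDiagonalTrace

end
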